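import Summits.BirchSwinnertonDyer.BirchSwinnertonDyer.Theorems.KatoDescentPotSupersingularTowerTorsionFiniteOrdinary
import Literature.NumberTheory.EllipticCurves.OrdinaryLocalReductionMapProofs
import HarnessLib

/-!
# Imai's finiteness at `p = 2`, the missing input: an element of the local cyclotomic tower group acting by INVERSION on `μ_{p^∞}`
# moves a `4`-torsion point (Weil pairing `e_4`) — route-free helper for crux M = stmt-BirchSwinnertonDyer-19196
# `ReducibleKatoMember` (K9 / K8-t′); seat `bsd-potss-rkm` g32

The kernel proof of Imai's theorem (FILES 1–3, `…TowerTorsionOrdinary{Bricks,Local}`, `…TowerTorsionFiniteOrdinary`, this seat) is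
parity-free EXCEPT for input (ii) of kmc's line-free reduction — «the local tower group `D_v ⊓ ker κ` moves a `p`-TORSION point»,
obtained for odd `p` from `μ_p ⊄ ℚ_p` (`TowerTorsionFinite.exists_pTorsion_not_fixed_rat`).  At `p = 2` that may fail (`E[2]` can be
rational over `ℚ_2 ∋ μ_2`); but a `4`-torsion point is always moved.  This file supplies the `p = 2` input:

* §1 `WeierstrassCurve.localTowerTorsionFiniteAt_of_noFixedStableDivisibleLine'` — FILE 2's / kmc g16's reduction with input (ii)
  weakened to «SOME point of `E(K̄)[p^∞]` is moved by `D_𝔭 ⊓ ker κ`» (the proof only uses it to see that the stable image is proper;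
  adapted verbatim);
* §2 `exists_mem_inertia_forall_smul_rootOfUnity_eq_inv` — at a place `v ∣ p` with `p` a uniformiser there is an INERTIA element
  `c ∈ I_𝔐 ≤ Γ_{K_v}` acting by INVERSION on every `p`-power root of unity of `K̄_v` (total ramification of `K_v(μ_{pⁿ})`,
  `exists_mem_inertia_smul_eq_of_isPrimitiveRoot`, along a compatible system + Cantor, as in `exists_isArithFrobAt_forall_smul_eq`);
* §3 `exists_mem_decomp_inf_kerSubgroup_forall_smul_rootOfUnity_eq_inv` — for `K = ℚ`, the place `v` at `p` and the CYCLOTOMIC `κ`: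
  its restriction `σ ∈ D_v` lies in `ker κ` (`χ(σ)² = 1`) and inverts every `p`-power root of unity of `ℚ̄`;
* §4 `exists_primaryTorsion_not_fixed_rat_two` — at `p = 2`: `σ` moves a point of `W(ℚ̄)[4] ⊆ W(ℚ̄)[2^∞]` (otherwise the Weil pairing
  `e_4(S, P) = ζ` with `ζ² ≠ 1` — `P` of order `4`, non-degeneracy at `2P ≠ 0` — would satisfy `ζ = σζ = ζ⁻¹`).

Theorems only (no definition, no named fact, no `sorry`); route-free; closes nothing by itself; BSD is proved for no curve.

References: [Imai1975] Theorem (p. 12); [GreenbergLNM1716] §3 Lemma 3.3 (p. 87); [SilvermanAEC2009] Prop. III.8.1, Cor. III.6.4;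
[NeukirchANT1999] Ch. II (7.13); [Washington1997] §13.1; tree: `LocalTowerTorsionFiniteOfNoStableDivisibleLine.lean` (kmc g16),
`CyclotomicTowerLocalFrobeniusProofs.lean` (the `e = 1` bricks), `WeilPairingProofs.lean`.
-/

-- the summit and its single problem are both named `BirchSwinnertonDyer` (registry layout D-0017)
set_option linter.dupNamespace false
set_option autoImplicit false

noncomputable section

open scoped Classical NumberField AddSubgroup NNReal
open Function Field NumberField IsDedekindDomain WeierstrassCurve
open Literature.NumberTheory.EllipticCurves Literature.NumberTheory.EllipticCurves.GreenbergSelmer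
open Literature.NumberTheory.GaloisRepresentations
open Summit.BirchSwinnertonDyer.BirchSwinnertonDyer.Theorems.SchneiderFreeAdditiveX3
open Summit.BirchSwinnertonDyer.BirchSwinnertonDyer.Theorems.SchneiderFreeControlAtoms

universe u

namespace Summit.BirchSwinnertonDyer.BirchSwinnertonDyer.Theorems.TowerTorsionFiniteOrdinary

/-! ## §1 The line-free reduction with ANY moved `p`-primary point -/

/-- **Fin_v from «no FIXED stable divisible line» and ANY point of `E(K̄)[p^∞]` moved by the tower group** — as
`WeierstrassCurve.localTowerTorsionFiniteAt_of_noFixedStableDivisibleLine` (FILE 2) with input (ii) weakened from a moved `p`-TORSION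
point to a moved `p`-PRIMARY point (kmc g16's proof, adapted verbatim: the moved point only serves to show that the stable image of the
fixed module is a PROPER subgroup). [cite: GreenbergLNM1716, §3 Lemma 3.3 (p. 87)]
[cite: JetchevSkinnerWan2017, Prop. 3.3.4 Case 3(b) (arXiv:1512.06894 p. 13)] -/
theorem _root_.WeierstrassCurve.localTowerTorsionFiniteAt_of_noFixedStableDivisibleLine'
    {K : Type} [Field K] [NumberField K] (E : WeierstrassCurve K) [E.IsElliptic] (p : ℕ)
    [hp : Fact p.Prime] (κ : ZpExtension K p) (𝔭 : HeightOneSpectrum (𝓞 K))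
    (hline : ∀ N : AddSubgroup (E.geomPrimaryTorsion p),
      (∀ d ∈ decomp 𝔭, ∀ c ∈ N, d • c ∈ N) → (∀ c ∈ N, ∃ c' ∈ N, p • c' = c) →
      Set.ncard {c : E.geomPrimaryTorsion p | c ∈ N ∧ p • c = 0} ≤ p →
      (∀ c ∈ N, ∀ g ∈ decomp 𝔭 ⊓ κ.kerSubgroup, g • c = c) → N = ⊥)
    (hmove : ∃ m : E.geomPrimaryTorsion p, ∃ g ∈ decomp 𝔭 ⊓ κ.kerSubgroup, g • m ≠ m) :
    LocalTowerTorsionFiniteAt E p κ 𝔭 := by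
  have hpr : p.Prime := hp.out
  unfold LocalTowerTorsionFiniteAt
  set M : AddSubgroup E.geomPoints := E.geomPrimaryTorsion p with hM
  set H : Subgroup (absoluteGaloisGroup K) := decomp 𝔭 ⊓ κ.kerSubgroup with hH
  set B : AddSubgroup M := FixedPoints.addSubgroup H M with hB
  by_contra hinf
  have hinfB : ¬ Finite B := fun h ↦ by
    haveI := h
    exact hinf (Set.toFinite _)
  -- `H` is normalised by `D_𝔭`: `d⁻¹ τ d ∈ H` for `d ∈ D_𝔭`, `τ ∈ H`
  have hconj : ∀ d ∈ decomp 𝔭, ∀ τ ∈ H, d⁻¹ * τ * d ∈ H := by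
    intro d hd τ hτ
    obtain ⟨hτD, hτk⟩ := Subgroup.mem_inf.mp hτ
    refine Subgroup.mem_inf.mpr ⟨(decomp 𝔭).mul_mem ((decomp 𝔭).mul_mem ((decomp 𝔭).inv_mem hd) hτD) hd, ?_⟩
    rw [ZpExtension.mem_kerSubgroup] at hτk ⊢
    rw [map_mul, map_mul, map_inv, hτk, mul_one, inv_mul_cancel]
  -- hence the fixed module `B` is `D_𝔭`-stable
  have hBstab : ∀ d ∈ decomp 𝔭, ∀ {m : M}, m ∈ B → d • m ∈ B := by
    intro d hd m hm
    rw [hB, FixedPoints.mem_addSubgroup] at hm ⊢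
    rintro ⟨τ, hτ⟩
    have h := hm ⟨d⁻¹ * τ * d, hconj d hd τ hτ⟩
    rw [Subgroup.mk_smul] at h ⊢
    calc τ • d • m = d • ((d⁻¹ * τ * d) • m) := by rw [mul_smul, mul_smul, smul_inv_smul]
      _ = d • m := by rw [h]
  -- `M` and `B` are `p`-primary, `B[p]` is finite
  have htorM : ∀ x : M, ∃ k : ℕ, p ^ k • x = 0 := fun x ↦ by
    obtain ⟨k, hk⟩ := x.2
    exact ⟨k, Subtype.ext (by rw [AddSubgroupClass.coe_nsmul, hk]; rfl)⟩
  have hprimB : ∀ b : B, ∃ k : ℕ, p ^ k • b = 0 := fun b ↦ by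
    obtain ⟨k, hk⟩ := htorM (b : M)
    exact ⟨k, Subtype.ext (by rw [AddSubgroupClass.coe_nsmul, hk]; rfl)⟩
  haveI : Finite (E.geomTorsion ((p : ℕ) : ℤ)) :=
    E.finite_torsionPoints_holds (AlgebraicClosure K) (by exact_mod_cast hpr.ne_zero)
  haveI : Finite ((B)[(p : ℕ)]) := by
    refine Finite.of_injective (fun x : (B)[(p : ℕ)] ↦
      (⟨(((x : B) : M) : E.geomPoints), ?_⟩ : E.geomTorsion ((p : ℕ) : ℤ))) ?_
    · refine AddSubgroup.torsionBy.nsmul_iff.mpr ?_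
      have h := congrArg (fun b : B ↦ ((b : M) : E.geomPoints))
        (AddSubgroup.torsionBy.nsmul_iff.mp x.2)
      simpa only [AddSubmonoidClass.coe_nsmul, ZeroMemClass.coe_zero] using h
    · intro x y hxy
      have h := congrArg Subtype.val hxy
      dsimp only at h
      exact Subtype.ext (Subtype.ext (Subtype.ext h))
  -- the stable image `D₀ = p^{j₀} B`: infinite and `p`-divisible
  obtain ⟨j₀, hj₀⟩ := PrimaryGroup.exists_powRange_succ_eq p hprimB
  obtain ⟨t, ht⟩ := PrimaryGroup.exists_card_quotient_powRange_le p hprimB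
  set D₀ : AddSubgroup B := (nsmulAddMonoidHom (p ^ j₀) : B →+ B).range with hD₀
  have hD₀inf : ¬ Finite D₀ := by
    intro hfin
    apply hinfB
    haveI := (ht j₀).1
    refine Nat.finite_of_card_ne_zero ?_
    rw [← AddSubgroup.card_mul_index D₀, AddSubgroup.index_eq_card]
    exact mul_ne_zero Nat.card_pos.ne' Nat.card_pos.ne'
  have hdiv₀ : ∀ x ∈ D₀, ∃ y ∈ D₀, p • y = x := by
    rintro x hx
    have hx' : x ∈ (nsmulAddMonoidHom (p ^ (j₀ + 1)) : B →+ B).range := by rw [hj₀]; exact hx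
    obtain ⟨c, rfl⟩ := hx'
    refine ⟨p ^ j₀ • c, ⟨c, rfl⟩, ?_⟩
    change p • p ^ j₀ • c = p ^ (j₀ + 1) • c
    rw [pow_succ', mul_smul]
  -- push the stable image down to `M = E[p^∞]`
  set N : AddSubgroup M := D₀.map B.subtype with hN
  have hNdiv : ∀ c ∈ N, ∃ c' ∈ N, p • c' = c := by
    rintro _ ⟨b, hb, rfl⟩
    obtain ⟨c, hc, hcb⟩ := hdiv₀ b hb
    exact ⟨B.subtype c, ⟨c, hc, rfl⟩, by rw [← map_nsmul, hcb]⟩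
  have hNstab : ∀ d ∈ decomp 𝔭, ∀ c ∈ N, d • c ∈ N := by
    rintro d hd _ ⟨b, ⟨c, rfl⟩, rfl⟩
    set c' : B := ⟨d • (c : M), hBstab d hd c.2⟩ with hc'
    refine ⟨p ^ j₀ • c', ⟨c', rfl⟩, ?_⟩
    rw [map_nsmul, nsmulAddMonoidHom_apply, map_nsmul, smul_comm d (p ^ j₀) (B.subtype c)]
    rfl
  have hNfix : ∀ c ∈ N, ∀ g ∈ H, g • c = c := by
    rintro _ ⟨b, -, rfl⟩ g hg
    have hb : (b : M) ∈ FixedPoints.addSubgroup H M := b.2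
    rw [FixedPoints.mem_addSubgroup] at hb
    have h := hb ⟨g, hg⟩
    rw [Subgroup.mk_smul] at h
    exact h
  -- `N ≠ ⊤` by (ii)
  have hNtop : N ≠ ⊤ := by
    intro htop
    obtain ⟨m, g, hg, hne⟩ := hmove
    exact hne (hNfix m (by rw [htop]; exact AddSubgroup.mem_top m) g hg)
  -- so `#N[p] ≤ p`, and (i) kills `N`
  have hN1 : Set.ncard {c : E.geomPrimaryTorsion p | c ∈ N ∧ p • c = 0} ≤ p :=
    ncard_pTorsion_le_of_divisible_of_ne_top N htorM (ncard_geomPrimaryTorsion_pTorsion_eq_sq E)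
      hNdiv hNtop
  have hNbot : N = ⊥ := hline N hNstab hNdiv hN1 hNfix
  apply hD₀inf
  haveI : Subsingleton D₀ := by
    refine ⟨fun x y ↦ Subtype.ext (B.subtype_injective ?_)⟩
    have hx : B.subtype (x : B) ∈ N := ⟨x, x.2, rfl⟩
    have hy : B.subtype (y : B) ∈ N := ⟨y, y.2, rfl⟩
    rw [hNbot, AddSubgroup.mem_bot] at hx hy
    rw [hx, hy]
  infer_instance

/-! ## §2 An inertia element inverting every `p`-power root of unity (`p` a uniformiser at `v`) -/

/-- **An inertia element acting by inversion on `μ_{p^∞}`.**  At a finite place `v ∣ p` of a number field `K` at which `p` is a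
uniformiser of `𝓞_v` (e.g. every `p` for `K = ℚ`), there is `c` in the inertia group `I_𝔐 ≤ Γ_{K_v}` with `c ξ = ξ⁻¹` for EVERY
`p`-power root of unity `ξ ∈ K̄_v`: for each `n` the inertia group acts transitively on the primitive `p^{n+1}`-th roots of unity
(`exists_mem_inertia_smul_eq_of_isPrimitiveRoot`: `K_v(μ_{pⁿ})/K_v` is totally ramified), so some inertia element sends `ζ_n` to
`ζ_n⁻¹`; along a compatible system these closed conditions are decreasing, and Cantor's intersection theorem in the compact inertia
group gives one `c` for all `n`. [cite: NeukirchANT1999, Ch. II (7.13)(i)] [cite: Washington1997, §13.1] -/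
theorem exists_mem_inertia_forall_smul_rootOfUnity_eq_inv {K : Type u} [Field K] [NumberField K] {v : HeightOneSpectrum (𝓞 K)}
    {w : Valuation (AlgebraicClosure (v.adicCompletion K)) ℝ≥0}
    (hw : ∀ x, (w x : ℝ) = spectralNorm (v.adicCompletion K) (AlgebraicClosure (v.adicCompletion K)) x)
    {𝔐 : Ideal v.localAbsIntegers} (h𝔐 : 𝔐 ∈ v.localPrimesAbove) {p : ℕ} [hp : Fact p.Prime]
    (hpv : (p : 𝓞 K) ∈ v.asIdeal) (hϖ : Irreducible ((p : ℕ) : v.adicCompletionIntegers K)) :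
    ∃ c ∈ 𝔐.inertia (absoluteGaloisGroup (v.adicCompletion K)),
      ∀ (k : ℕ) (ξ : AlgebraicClosure (v.adicCompletion K)), ξ ^ p ^ k = 1 → c • ξ = ξ⁻¹ := by
  haveI : CharZero (v.adicCompletion K) :=
    charZero_of_injective_algebraMap (algebraMap K (v.adicCompletion K)).injective
  haveI : CharZero (AlgebraicClosure (v.adicCompletion K)) := charZero_of_injective_algebraMap
    (algebraMap (v.adicCompletion K) (AlgebraicClosure (v.adicCompletion K))).injective
  have hpp := hp.out
  set I : Subgroup (absoluteGaloisGroup (v.adicCompletion K)) :=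
    𝔐.inertia (absoluteGaloisGroup (v.adicCompletion K)) with hIdef
  obtain ⟨z, hz, hzp⟩ : ∃ z : ℕ → AlgebraicClosure (v.adicCompletion K),
      (∀ n, IsPrimitiveRoot (z n) (p ^ (n + 1))) ∧ ∀ n, z (n + 1) ^ p = z n :=
    IsDedekindDomain.HeightOneSpectrum.exists_compatible_primitiveRoots
  -- the roots and their inverses as local absolute integers
  have hz1 : ∀ n, w (z n) ≤ 1 := fun n ↦
    (val_eq_one_of_pow_eq_one w (pow_ne_zero _ hpp.ne_zero) (hz n).pow_eq_one).le
  have hz1' : ∀ n, w (z n)⁻¹ ≤ 1 := fun n ↦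
    (val_eq_one_of_pow_eq_one w (pow_ne_zero _ hpp.ne_zero) (hz n).inv.pow_eq_one).le
  let b : ℕ → v.localAbsIntegers := fun n ↦
    ⟨z n, (IsDedekindDomain.HeightOneSpectrum.mem_localAbsIntegers_iff_spectralValuation hw).mpr (hz1 n)⟩
  let b' : ℕ → v.localAbsIntegers := fun n ↦
    ⟨(z n)⁻¹, (IsDedekindDomain.HeightOneSpectrum.mem_localAbsIntegers_iff_spectralValuation hw).mpr (hz1' n)⟩
  have hb : ∀ (n : ℕ) (τ : absoluteGaloisGroup (v.adicCompletion K)),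
      ((τ • b n : v.localAbsIntegers) : AlgebraicClosure (v.adicCompletion K)) = τ • z n :=
    fun n τ ↦ integralClosure.coe_smul _ _
  -- the closed sets `S n = {ι ∈ I | ι ζ_n = ζ_n⁻¹}`
  let S : ℕ → Set (absoluteGaloisGroup (v.adicCompletion K)) := fun n ↦
    (I : Set (absoluteGaloisGroup (v.adicCompletion K))) ∩ {τ | τ • b n = b' n}
  have hSmem : ∀ n τ, τ ∈ S n ↔ τ ∈ I ∧ τ • z n = (z n)⁻¹ := fun n τ ↦ by
    change τ ∈ (I : Set (absoluteGaloisGroup (v.adicCompletion K))) ∧ τ • b n = b' n ↔ _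
    rw [SetLike.mem_coe, Subtype.ext_iff, hb]
  have hIclosed : IsClosed (I : Set (absoluteGaloisGroup (v.adicCompletion K))) := by
    have e : (I : Set (absoluteGaloisGroup (v.adicCompletion K))) =
        ⋂ x : v.localAbsIntegers, {g : absoluteGaloisGroup (v.adicCompletion K) | g • x - x ∈ 𝔐} := by
      ext g
      simp only [Set.mem_iInter, SetLike.mem_coe, Set.mem_setOf_eq]
      rfl
    rw [e]
    exact isClosed_iInter fun x ↦ IsDedekindDomain.HeightOneSpectrum.isClosed_setOf_smul_sub_mem_local v 𝔐 x
  have hclosed : ∀ n, IsClosed (S n) := fun n ↦ by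
    refine hIclosed.inter ?_
    letI : TopologicalSpace v.localAbsIntegers := ⊥
    haveI : DiscreteTopology v.localAbsIntegers := ⟨rfl⟩
    haveI := absIntegers.continuousSMul (v.adicCompletionIntegers K) (K := v.adicCompletion K)
    have hc : Continuous fun g : absoluteGaloisGroup (v.adicCompletion K) ↦ g • b n :=
      continuous_id.smul continuous_const
    exact (isClosed_discrete {y : v.localAbsIntegers | y = b' n}).preimage hc
  have hanti : ∀ n, S (n + 1) ⊆ S n := fun n τ hτ ↦ by
    rw [hSmem] at hτ ⊢
    refine ⟨hτ.1, ?_⟩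
    rw [← hzp n, smul_pow', hτ.2, inv_pow]
  have hne : ∀ n, (S n).Nonempty := fun n ↦ by
    obtain ⟨ι, hι, hιz⟩ := IsDedekindDomain.HeightOneSpectrum.exists_mem_inertia_smul_eq_of_isPrimitiveRoot hw h𝔐 hpv hϖ n
      (hz n) (hz n).inv
    exact ⟨ι, (hSmem n ι).mpr ⟨hι, hιz⟩⟩
  obtain ⟨c, hc⟩ := IsCompact.nonempty_iInter_of_sequence_nonempty_isCompact_isClosed S hanti hne
    (hclosed 0).isCompact hclosed
  have hcI : c ∈ I := ((hSmem 0 c).mp (Set.mem_iInter.mp hc 0)).1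
  have hcz : ∀ n, c • z n = (z n)⁻¹ := fun n ↦ ((hSmem n c).mp (Set.mem_iInter.mp hc n)).2
  refine ⟨c, hcI, fun k ξ hξ ↦ ?_⟩
  cases k with
  | zero =>
    rw [pow_zero, pow_one] at hξ
    rw [hξ, smul_one, inv_one]
  | succ k =>
    obtain ⟨i, -, rfl⟩ := (hz k).eq_pow_of_pow_eq_one hξ
    rw [smul_pow', hcz k, inv_pow]

/-! ## §3 `K = ℚ`: an element of `D_v ⊓ ker κ` inverting `μ_{p^∞}(ℚ̄)` -/

/-- **For `K = ℚ`, the place `v` at `p` and the cyclotomic `ℤ_p`-extension `κ`: some `σ ∈ D_v ⊓ ker κ` inverts every `p`-power root of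
unity of `ℚ̄`** — the restriction of §2's inertia element (`p` is a uniformiser of `ℤ_p`); `σ² ` fixes `μ_{p^∞}`, so `χ_p(σ)² = 1` is
torsion and `σ ∈ ker κ = χ_p⁻¹(μ(ℤ_p))`. [cite: Washington1997, §13.1] [cite: NeukirchANT1999, Ch. II (7.13)(i)] -/
theorem exists_mem_decomp_inf_kerSubgroup_forall_smul_rootOfUnity_eq_inv (p : ℕ) [hp : Fact p.Prime] (κ : ZpExtension ℚ p)
    (hκ : κ.IsCyclotomic) (v : HeightOneSpectrum (𝓞 ℚ)) (hpv : (p : 𝓞 ℚ) ∈ v.asIdeal) :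
    ∃ σ ∈ decomp v ⊓ κ.kerSubgroup, ∀ (k : ℕ) (t : AlgebraicClosure ℚ), t ^ p ^ k = 1 → σ • t = t⁻¹ := by
  have hpp := hp.out
  obtain ⟨w, hw⟩ := v.exists_spectralValuation
  obtain ⟨𝔐, h𝔐⟩ := v.localPrimesAbove_nonempty
  have hϖ := IsDedekindDomain.HeightOneSpectrum.irreducible_natCast_adicCompletionIntegers_rat (v := v) hpv
  obtain ⟨c, -, hc⟩ := exists_mem_inertia_forall_smul_rootOfUnity_eq_inv hw h𝔐 hpv hϖ
  set σ : absoluteGaloisGroup ℚ := absGaloisRestrict ℚ (v.adicCompletion ℚ) c with hσ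
  -- `σ` inverts the `p`-power roots of unity of `ℚ̄`
  have hσinv : ∀ (k : ℕ) (t : AlgebraicClosure ℚ), t ^ p ^ k = 1 → σ • t = t⁻¹ := by
    intro k t ht
    apply (closureEmb (K := ℚ) (v.adicCompletion ℚ)).toRingHom.injective
    have h1 : closureEmb (K := ℚ) (v.adicCompletion ℚ) (σ • t) = c • closureEmb (K := ℚ) (v.adicCompletion ℚ) t := by
      rw [hσ, ← WeierstrassCurve.resGal_eq_absGaloisRestrict, resGal_eq]
      exact apply_resGalAuxOfEmb_apply _ _ t
    change closureEmb (K := ℚ) (v.adicCompletion ℚ) (σ • t) = closureEmb (K := ℚ) (v.adicCompletion ℚ) t⁻¹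
    rw [h1, map_inv₀]
    exact hc k _ (by rw [← map_pow, ht, map_one])
  refine ⟨σ, Subgroup.mem_inf.mpr ⟨?_, ?_⟩, hσinv⟩
  · change σ ∈ (absGaloisRestrict ℚ (v.adicCompletion ℚ)).toMonoidHom.range
    exact ⟨c, hσ.symm⟩
  · -- `σ² ∈ ker κ`, hence `σ ∈ ker κ` (the kernel is `χ⁻¹(torsion)`)
    have h2 : σ ^ 2 ∈ κ.kerSubgroup := by
      refine mem_kerSubgroup_of_forall_smul_rootOfUnity_eq κ hκ fun k t ht ↦ ?_
      rw [pow_two, mul_smul, hσinv k t ht, smul_inv'', hσinv k t ht, inv_inv]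
    rw [show κ.kerSubgroup = _ from hκ, Subgroup.mem_comap, CommGroup.mem_torsion] at h2 ⊢
    rw [map_pow] at h2
    exact IsOfFinOrder.of_pow h2 two_ne_zero

/-! ## §4 At `p = 2` the tower group moves a `4`-torsion point -/

/-- **At the place of `ℚ` above `2` the local cyclotomic tower group `D_v ⊓ ker κ` moves some point of `W(ℚ̄)[2^∞]`** (a `4`-torsion
point): with `σ` as in §3 (inverting `μ_{2^∞}`), a point `P ∈ W[4]` of order `4` and `S` with `ζ = e_4(S, P)` of order `4`
(non-degeneracy of the Weil pairing at `2P ≠ 0`), if `σ` fixed both `S` and `P` then `ζ = e_4(σS, σP) = σζ = ζ⁻¹`, i.e. `ζ² = 1`.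
[cite: SilvermanAEC2009, Prop. III.8.1 and Cor. III.6.4] [cite: Washington1997, §13.1] -/
theorem exists_primaryTorsion_not_fixed_rat_two (W : WeierstrassCurve ℚ) [W.IsElliptic] (p : ℕ) [hp : Fact p.Prime]
    (hp2 : p = 2) (κ : ZpExtension ℚ p) (hκ : κ.IsCyclotomic) (v : HeightOneSpectrum (𝓞 ℚ))
    (hv : ((Rat.HeightOneSpectrum.primesEquiv v : Nat.Primes) : ℕ) = p) :
    ∃ m : W.geomPrimaryTorsion p, ∃ g ∈ decomp v ⊓ κ.kerSubgroup, g • m ≠ m := by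
  have hpp : p.Prime := hp.out
  have hpv : ((p : ℕ) : 𝓞 ℚ) ∈ v.asIdeal :=
    (natCast_mem_asIdeal_iff_eq_primesEquiv_symm v hpp).mpr ((Equiv.eq_symm_apply _).mpr (Subtype.ext hv))
  obtain ⟨σ, hσ, hσinv⟩ := exists_mem_decomp_inf_kerSubgroup_forall_smul_rootOfUnity_eq_inv p κ hκ v hpv
  -- the Weil pairing on `W[p²] = W[4]`
  have hp0 : (p : ℚ) ≠ 0 := Nat.cast_ne_zero.mpr hpp.ne_zero
  set m : ℕ := p ^ 2 with hmdef
  have hm2 : 2 ≤ m := by rw [hmdef, hp2]; norm_num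
  have hm0 : m ≠ 0 := by omega
  have hmQ : (m : ℚ) ≠ 0 := Nat.cast_ne_zero.mpr hm0
  obtain ⟨e, hpow, haddl, haddr, halt, hnd, hgal⟩ := W.exists_weilPairing_holds m hm2 hmQ
  -- a point `P ∈ W[p²] \ W[p]`
  have hcard2 : Nat.card (geomTorsion W ((p ^ 2 : ℕ) : ℤ)) = p ^ (2 * 2) :=
    card_geomTorsion_pow_eq W p (card_torsionPoints_eq_sq_holds W (AlgebraicClosure ℚ)) hp0 2
  have hcard1 : Nat.card (geomTorsion W ((p ^ 1 : ℕ) : ℤ)) = p ^ (2 * 1) :=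
    card_geomTorsion_pow_eq W p (card_torsionPoints_eq_sq_holds W (AlgebraicClosure ℚ)) hp0 1
  haveI : Finite (geomTorsion W ((p ^ 2 : ℕ) : ℤ)) :=
    Nat.finite_of_card_ne_zero (by rw [hcard2]; exact pow_ne_zero _ hpp.ne_zero)
  haveI : Finite (geomTorsion W ((p ^ 1 : ℕ) : ℤ)) :=
    Nat.finite_of_card_ne_zero (by rw [hcard1]; exact pow_ne_zero _ hpp.ne_zero)
  obtain ⟨P, hP⟩ : ∃ P : geomTorsion W (m : ℤ), p • P ≠ 0 := by
    by_contra hall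
    push Not at hall
    -- then `W[p²] ↪ W[p]`, contradicting the cardinalities
    have hinj : Function.Injective (fun P : geomTorsion W (m : ℤ) ↦
        (⟨(P : geomPoints W), (mem_geomTorsion_iff W _ _).mpr (by
          have h := congrArg (fun Q : geomTorsion W (m : ℤ) ↦ (Q : geomPoints W)) (hall P)
          simpa only [AddSubgroupClass.coe_nsmul, ZeroMemClass.coe_zero, pow_one, natCast_zsmul] using h)⟩ :
          geomTorsion W ((p ^ 1 : ℕ) : ℤ))) := by
      intro P Q hPQ
      have h := congrArg Subtype.val hPQ
      exact Subtype.ext h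
    have hle := Nat.card_le_card_of_injective _ hinj
    rw [hmdef] at hle
    rw [hcard2, hcard1, hp2] at hle
    norm_num at hle
  -- a partner `S` with `e(S, P)` of order `4`: non-degeneracy at `p • P ≠ 0`
  obtain ⟨S, hS⟩ : ∃ S : geomTorsion W (m : ℤ), e S (p • P) ≠ 1 := by
    by_contra hall
    push Not at hall
    exact hP (hnd _ hall)
  have hnsmul_right : ∀ (j : ℕ) (A B : geomTorsion W (m : ℤ)), e A (j • B) = e A B ^ j := by
    intro j A B
    induction j with
    | zero =>
      rw [zero_smul, pow_zero]
      have h := haddr A 0 0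
      rw [add_zero] at h
      have hne : e A 0 ≠ 0 := fun h0 ↦ by
        have h1 := hpow A 0
        rw [h0, zero_pow hm0] at h1
        exact zero_ne_one h1
      exact (mul_eq_left₀ hne).mp h.symm
    | succ j ih => rw [succ_nsmul, haddr, ih, pow_succ]
  set ζ := e S P with hζ
  have hζ2 : ζ ^ p ≠ 1 := by rw [hζ, ← hnsmul_right]; exact hS
  have hζpow : ζ ^ p ^ 2 = 1 := hpow S P
  -- if `σ` fixed `S` and `P`, then `ζ = σ ζ = ζ⁻¹`
  by_contra hcon
  push Not at hcon
  have hfix : ∀ T : geomTorsion W (m : ℤ), σ • T = T := fun T ↦ by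
    obtain ⟨k, hk⟩ : ∃ k : ℕ, p ^ k • (T : geomPoints W) = 0 :=
      ⟨2, by rw [← natCast_zsmul, ← hmdef]; exact (mem_geomTorsion_iff W _ _).mp T.2⟩
    have h := hcon ⟨(T : geomPoints W), ⟨k, hk⟩⟩ σ hσ
    have h' := congrArg (fun x : W.geomPrimaryTorsion p ↦ (x : geomPoints W)) h
    simp only [primaryComponent.coe_smul] at h'
    exact Subtype.ext (by rw [Literature.NumberTheory.EllipticCurves.AddSubgroup.torsionBy.coe_smul]; exact h')
  have hσζ : σ • ζ = ζ⁻¹ := hσinv 2 ζ hζpow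
  have hσζ' : σ • ζ = ζ := by rw [hζ, hgal, hfix, hfix]
  have hζsq : ζ ^ 2 = 1 := by
    have hne : ζ ≠ 0 := fun h0 ↦ by rw [h0, zero_pow (pow_ne_zero _ hpp.ne_zero)] at hζpow; exact zero_ne_one hζpow
    have h : ζ = ζ⁻¹ := hσζ'.symm.trans hσζ
    rw [pow_two]
    nth_rewrite 2 [h]
    exact mul_inv_cancel₀ hne
  exact hζ2 (by rw [hp2]; exact hζsq)

end Summit.BirchSwinnertonDyer.BirchSwinnertonDyer.Theorems.TowerTorsionFiniteOrdinary

end
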